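/-
Copyright: the b2b-balaban T⁴-continuum CRUX team, row NE7b OWNER lineage `t4-ne7b-p1` (gen 117). Project licence.
-/
import Summits.QuantumFields.BalabanUV.T4Continuum.Spine.NE7b.SupTorusEffectiveActionConvex

/-!
# THE EFFECTIVE ACTION IS `C¹` ON THE WHOLE COARSE CARRIER WITHOUT DIFFERENTIATING THE BACKGROUND: for ANY background map `Φ`
# (block means `Q′t(Φ w) = w`, sitewise equation at every `w` — it exists uniquely by (93) when `u′ ≥ −λ`, `λ < min(2,a)`) the
# effective action `w ↦ S(Φ w)` has derivative `vol·⟨λ(w), –⟩` AT EVERY `w`, `λ(w)` INST's next-equation reading — an envelope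
# (Danskin) theorem from the first-order letter alone: `0 ≤ S(Φ w′) − S(Φ w) − DS(Φ w)(M(w′ − w)) ≤ o(‖w′ − w‖)` by minimality on the
# fibre of `w′` against the shifted background `Φ w + M(w′ − w)`; plus THE VACUUM LETTER (`u 0 = 0`: the zero field is the background
# of the zero block field and `S φ ≥ S 0 + ½(min(2,a) − λ)(n+1)^d·Σ_y (Q′t φ)²`) and the LIPSCHITZ INVERSE of the next equation map
# (row NE7b, node U5c; (92) + (93) + (94) + TEA + INST BY NAME; [folklore])

Cell `pub-balaban`, sub-cell `t4`, spine estimate NE7b (`T4WeightBudget.RelWeightBound`; the cell's OWN estimate — NOT PRINTED in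
[Bałaban 1983–89], NOT PROVED).  Crux-route work under `Spine/NE7b/` by the row OWNER (`t4-ne7b-p1` gen 117) under FREEZE (0)'s
crux-prover clause; NOTHING of Bałaban's is named as a Lean object, valued or asserted; no `T4Continuum/Support` leaf typed; no `def`,
no notation (background maps are quantified, not constructed; the block lift enters as ANY right inverse `M` of `Q′t` with its
displayed action); zero `sorry`.  Imports (BY NAME): the OWNER's (94) `…SupTorusEffectiveActionConvex` (`nextEquation_strongMonotone`;
through it (92) `action_firstOrder_lower` ∕ `isMinOn_fibre_of_critical`, (93) `existsUnique_torus_background` ∕ `blockAvg_blockLift`,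
(89) `torus_form_coercive` ∕ `blockVolume_mul_sum_sq_blockAvg_le`, TEA `exists_clm_pair` ∕ `hasFDerivAt_action` ∕ `fderiv_action_apply`,
INST `pairing_of_sitewise` ∕ `fderiv_action_torus_eq_zero`, TDF `torus_operator_form_symm`).

WHY (located).  INST ∕ TEA computed the gradient of the effective action `S∘σt` through the chain rule, hence only where the sup
road's chart makes `σt` differentiable (SBTL's small ball, two-sided letters).  In the convex regime of (92)–(94) the background map
need not be differentiated at all: at `w`, compare `S(Φ w′)` with the SHIFTED background `Φ w + M(w′ − w)`, which lies on the fibre of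
`w′`.  Minimality of `Φ w′` on its fibre gives `S(Φ w′) ≤ S(Φ w + M(w′ − w)) = S(Φ w) + DS(Φ w)(M(w′ − w)) + o(‖w′ − w‖)`
(differentiability of `S` at ONE point), and the first-order letter at `Φ w` gives `S(Φ w′) ≥ S(Φ w) + DS(Φ w)(Φ w′ − Φ w)`, where
`DS(Φ w)` kills `Φ w′ − Φ w − M(w′ − w) ∈ ker Q′t`.  So the remainder of `w ↦ S(Φ w)` against the covector `DS(Φ w)∘M` is squeezed
between `0` and an `o(‖w′ − w‖)`: the effective action is differentiable at every `w`, with gradient `DS(Φ w)∘M = vol·⟨λ(w), –⟩` by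
INST's pairing form of the sitewise equation — on the WHOLE coarse carrier, for every mesh, period, dimension, and for `φ⁴` with
`g ≥ 0`, `−m < min(2,a)`.

WHAT IS PROVED ([folklore]):
* §1 (TEA's level: symmetric `At` with floor `γ`, `v′ = u`, `u′ ≥ −λ`, `λ ≤ γ`; ANY `Qt` with a right inverse `M`)
  **`hasFDerivAt_fibreMin_comp`** (for ANY map `Φ` with `Qt (Φ w) = w` and `DS(Φ w)` killing `ker Qt` at every `w`:
  `HasFDerivAt (S ∘ Φ) ((fderiv S (Φ w)).comp M) w` at EVERY `w`), `fderiv_fibreMin_comp_apply_of_pairing` (with a pairing letter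
  `DS(Φ w) = vol·⟨c, Qt –⟩`: the derivative is `k ↦ vol·Σ_y c y·k y`), `action_vacuum_lower` (`u 0 = 0` ⟹
  `S 0 + ½(γ − λ)Σ ψ² ≤ S ψ`), `sq_sum_le_of_strongMonotone` (a strongly monotone map has a Lipschitz inverse:
  `m²·Σ(w − w′)² ≤ Σ(c − c′)²`).
* §2 (the `Beta.Site` carriers, displayed actions; `u′ ≥ −λ`, `λ < min(2,a)`) `exists_clm_blockLift` (the block lift as a continuous
  linear right inverse of `Q′t`), THE END **`torus_hasFDerivAt_effectiveAction_global`** (ANY background map `Φ`, EVERY `wt`, ANY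
  covector `Lc` with action `k ↦ Σ_y λ(wt) y·k y`: `HasFDerivAt (fun w => S (Φ w)) ((n+1)^d • Lc) wt`),
  **`torus_background_zero`** (`u 0 = 0`: the background of the zero block field is the zero field), **`torus_action_vacuum_lower`**
  (`S 0 + ½(min(2,a) − λ)·Σ_x φ² ≤ S φ` and `S 0 + ½(min(2,a) − λ)(n+1)^d·Σ_y (Q′t φ)² ≤ S φ` for every `φ`),
  **`torus_blockField_le_of_nextEquation`** (`(min(2,a) − λ)²·Σ_y (w − w′)² ≤ Σ_y (λ − λ′)²` between two backgrounds: the block field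
  is a Lipschitz function of the renormalised source).
* §3 toy.

HONEST (what this is NOT).  An envelope theorem + (92)–(94) by name; `C¹` only (no statement on the continuity modulus of `∇W` beyond
strong monotonicity; `C²` needs the chart: (90)∕(91)); one-sided curvature; the constants `min(2,a) − λ` OURS; nothing about the measure;
cubic periods; scalar skeleton, hard constraint ((A3), NC-NE7b-α UNRULED); nothing of Bałaban's.  BY-NAME EFFECT ON THE WALL: NONE.  NE7b
NOT PRINTED ∕ NOT PROVED; spine PROVED 0∕9; rung (B)+1 on a FINITE torus — NOT infinite volume, NOT the mass gap, NOT Clay.  HONEST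
DEPENDENCY: continuum YM on T⁴ ⇐ BetaPertH ∧ nine spine estimates (0∕9 proved); BetaPertH ⇐ (D1) ∧ (D4) ∧ CAP+tail; G-an2-4 gates asym,
D1 and NE2∕3∕4.
-/

set_option autoImplicit false

noncomputable section

namespace Summit.QuantumFields.BalabanUV.T4Continuum.NE7b.SupTorusEffectiveActionGradient

open Set Function Filter Asymptotics
open scoped ENNReal Topology
open Literature.MathematicalPhysics.QuantumFieldTheory.Balaban1983to89
open B6QGQLower276 (X blk B side AX)
open B5Hk103ScalarZd (nbhd)
open Beta (Site siteOf windowMap)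
open SupTorusDirichletForm (torus_operator_form_symm)
open SupTorusDirichletFormCoercive (torus_form_coercive blockVolume_mul_sum_sq_blockAvg_le)
open SupTorusEffectiveAction (exists_clm_pair hasFDerivAt_action fderiv_action_apply)
open SupTorusEffectiveActionInstance (pairing_of_sitewise fderiv_action_torus_eq_zero)
open SupTorusActionConvex (action_firstOrder_lower isMinOn_fibre_of_critical)
open SupTorusActionMinimiser (existsUnique_torus_background blockAvg_blockLift)
open SupTorusEffectiveActionConvex (nextEquation_strongMonotone)

variable {d : ℕ}

/-! ## §1. TEA's level: the envelope theorem, the vacuum letter, the Lipschitz inverse -/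

section Generic

variable {ι κ : Type*} [Fintype ι] [Fintype κ]

/-- **THE ENVELOPE THEOREM FOR THE FIBRE MINIMUM** (no derivative of the background map): symmetric `At` with a form floor `γ`, `v′ = u`,
`u′ ≥ −λ`, `λ ≤ γ`; `Qt` with a continuous linear right inverse `M`; `Φ` ANY map with `Qt (Φ w) = w` whose values are fibre-critical
(`DS(Φ w)` kills `ker Qt`).  Then at EVERY `w`: `HasFDerivAt (fun w ↦ S (Φ w)) ((fderiv S (Φ w)).comp M) w`. [folklore] -/
theorem hasFDerivAt_fibreMin_comp (At : (ι → ℝ) →L[ℝ] (ι → ℝ))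
    (hAt : ∀ φ ψ : ι → ℝ, ∑ x, ψ x * At φ x = ∑ x, φ x * At ψ x) {γ : ℝ}
    (hγ : ∀ h : ι → ℝ, γ * ∑ x, h x ^ 2 ≤ ∑ x, h x * At h x) {v u u' : ℝ → ℝ} (hv : ∀ t, HasDerivAt v (u t) t)
    (hu : ∀ t, HasDerivAt u (u' t) t) {lam : ℝ} (hu' : ∀ t, -lam ≤ u' t) (hγlam : lam ≤ γ)
    (Qt : (ι → ℝ) →L[ℝ] (κ → ℝ)) (M : (κ → ℝ) →L[ℝ] (ι → ℝ)) (hM : ∀ k : κ → ℝ, Qt (M k) = k)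
    (Φ : (κ → ℝ) → (ι → ℝ)) (hΦQ : ∀ w, Qt (Φ w) = w)
    (hΦcrit : ∀ (w : κ → ℝ) (h : ι → ℝ), Qt h = 0 →
      fderiv ℝ (fun φ : ι → ℝ => (1 / 2 : ℝ) * ∑ x, φ x * At φ x + ∑ x, v (φ x)) (Φ w) h = 0)
    (w : κ → ℝ) :
    HasFDerivAt (fun w' : κ → ℝ => (1 / 2 : ℝ) * ∑ x, Φ w' x * At (Φ w') x + ∑ x, v (Φ w' x))
      ((fderiv ℝ (fun φ : ι → ℝ => (1 / 2 : ℝ) * ∑ x, φ x * At φ x + ∑ x, v (φ x)) (Φ w)).comp M) w := by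
  -- the action, its differential at `Φ w`
  obtain ⟨D, hD⟩ := exists_clm_pair (fun x => At (Φ w) x + u (Φ w x))
  have hS : HasFDerivAt (fun φ : ι → ℝ => (1 / 2 : ℝ) * ∑ x, φ x * At φ x + ∑ x, v (φ x)) D (Φ w) :=
    hasFDerivAt_action At hAt hv (Φ w) hD
  have hDf : fderiv ℝ (fun φ : ι → ℝ => (1 / 2 : ℝ) * ∑ x, φ x * At φ x + ∑ x, v (φ x)) (Φ w) = D := hS.fderiv
  rw [hDf]
  -- the shifted background `w′ ↦ Φ w + (M w′ − M w)` and the action along it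
  have haff : HasFDerivAt (fun w' : κ → ℝ => Φ w + (M w' - M w)) M w :=
    ((M.hasFDerivAt).sub_const (M w)).const_add (Φ w)
  have hg : HasFDerivAt (fun w' : κ → ℝ => (1 / 2 : ℝ) * ∑ x, (Φ w + (M w' - M w)) x * At (Φ w + (M w' - M w)) x
      + ∑ x, v ((Φ w + (M w' - M w)) x)) (D.comp M) w := by
    have hS' : HasFDerivAt (fun φ : ι → ℝ => (1 / 2 : ℝ) * ∑ x, φ x * At φ x + ∑ x, v (φ x)) D (Φ w + (M w - M w)) := by
      rw [sub_self, add_zero]; exact hS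
    exact hS'.comp w haff
  -- the squeeze `0 ≤ F w′ ≤ G w′`
  have hupper : ∀ w' : κ → ℝ,
      (1 / 2 : ℝ) * ∑ x, Φ w' x * At (Φ w') x + ∑ x, v (Φ w' x)
        ≤ (1 / 2 : ℝ) * ∑ x, (Φ w + (M w' - M w)) x * At (Φ w + (M w' - M w)) x + ∑ x, v ((Φ w + (M w' - M w)) x) := by
    intro w'
    have hmin := isMinOn_fibre_of_critical At hAt hγ hv hu hu' hγlam Qt (hΦcrit w')
    refine isMinOn_iff.1 hmin (Φ w + (M w' - M w)) ?_
    show Qt (Φ w + (M w' - M w)) = Qt (Φ w')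
    rw [map_add, map_sub, hM, hM, hΦQ, hΦQ]; abel
  have hlower : ∀ w' : κ → ℝ,
      (1 / 2 : ℝ) * ∑ x, Φ w x * At (Φ w) x + ∑ x, v (Φ w x) + D (M (w' - w))
        ≤ (1 / 2 : ℝ) * ∑ x, Φ w' x * At (Φ w') x + ∑ x, v (Φ w' x) := by
    intro w'
    have h1 := action_firstOrder_lower At hAt hγ hv hu hu' (Φ w) (Φ w')
    rw [hDf] at h1
    -- `D (Φ w′ − Φ w) = D (M (w′ − w))`: the difference lies in `ker Qt`
    have hker : Qt (Φ w' - Φ w - M (w' - w)) = 0 := by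
      rw [map_sub, map_sub, hΦQ, hΦQ, hM]; abel
    have hkill := hΦcrit w (Φ w' - Φ w - M (w' - w)) hker
    rw [hDf, map_sub] at hkill
    have hDeq : D (Φ w' - Φ w) = D (M (w' - w)) := sub_eq_zero.1 hkill
    have hnn : 0 ≤ (γ - lam) / 2 * ∑ x, (Φ w' x - Φ w x) ^ 2 :=
      mul_nonneg (div_nonneg (sub_nonneg.2 hγlam) zero_le_two) (Finset.sum_nonneg fun x _ => sq_nonneg _)
    rw [hDeq] at h1
    linarith
  -- conclude by the little-o squeeze
  rw [hasFDerivAt_iff_isLittleO_nhds_zero] at hg ⊢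
  refine IsBigO.trans_isLittleO (IsBigO.of_bound 1 (Eventually.of_forall fun h => ?_)) hg
  have hF0 : 0 ≤ (1 / 2 : ℝ) * ∑ x, Φ (w + h) x * At (Φ (w + h)) x + ∑ x, v (Φ (w + h) x)
      - ((1 / 2 : ℝ) * ∑ x, Φ w x * At (Φ w) x + ∑ x, v (Φ w x)) - (D.comp M) h := by
    have hl := hlower (w + h)
    rw [add_sub_cancel_left] at hl
    rw [ContinuousLinearMap.comp_apply]
    linarith
  have hFG : (1 / 2 : ℝ) * ∑ x, Φ (w + h) x * At (Φ (w + h)) x + ∑ x, v (Φ (w + h) x)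
      - ((1 / 2 : ℝ) * ∑ x, Φ w x * At (Φ w) x + ∑ x, v (Φ w x)) - (D.comp M) h
      ≤ (1 / 2 : ℝ) * ∑ x, (Φ w + (M (w + h) - M w)) x * At (Φ w + (M (w + h) - M w)) x
          + ∑ x, v ((Φ w + (M (w + h) - M w)) x)
        - ((1 / 2 : ℝ) * ∑ x, (Φ w + (M w - M w)) x * At (Φ w + (M w - M w)) x + ∑ x, v ((Φ w + (M w - M w)) x))
        - (D.comp M) h := by
    have hu1 := hupper (w + h)
    simp only [sub_self, add_zero]
    linarith
  rw [Real.norm_eq_abs, Real.norm_eq_abs, abs_of_nonneg hF0, one_mul]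
  exact hFG.trans (le_abs_self _)

/-- **THE DERIVATIVE READ THROUGH A PAIRING LETTER**: if `DS(Φ w)` pairs like `vol·⟨c, Qt –⟩`, then `((fderiv S (Φ w)).comp M) k =
vol·Σ_y c y·k y`. [folklore] -/
theorem fderiv_fibreMin_comp_apply_of_pairing (At : (ι → ℝ) →L[ℝ] (ι → ℝ))
    (hAt : ∀ φ ψ : ι → ℝ, ∑ x, ψ x * At φ x = ∑ x, φ x * At ψ x) {v u : ℝ → ℝ} (hv : ∀ t, HasDerivAt v (u t) t)
    (Qt : (ι → ℝ) →L[ℝ] (κ → ℝ)) (M : (κ → ℝ) →L[ℝ] (ι → ℝ)) (hM : ∀ k : κ → ℝ, Qt (M k) = k) {φ : ι → ℝ} {vol : ℝ}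
    {c : κ → ℝ} (hpair : ∀ h : ι → ℝ, ∑ x, (At φ x + u (φ x)) * h x = vol * ∑ y, c y * Qt h y) (k : κ → ℝ) :
    ((fderiv ℝ (fun φ : ι → ℝ => (1 / 2 : ℝ) * ∑ x, φ x * At φ x + ∑ x, v (φ x)) φ).comp M) k = vol * ∑ y, c y * k y := by
  rw [ContinuousLinearMap.comp_apply, fderiv_action_apply At hAt hv φ (M k), hpair, hM]

/-- **THE VACUUM LETTER**: `u 0 = 0` ⟹ `S 0 + ½(γ − λ)·Σ_x ψ x² ≤ S ψ` for every `ψ` (the first-order letter at the zero field, whose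
differential vanishes). [folklore] -/
theorem action_vacuum_lower (At : (ι → ℝ) →L[ℝ] (ι → ℝ))
    (hAt : ∀ φ ψ : ι → ℝ, ∑ x, ψ x * At φ x = ∑ x, φ x * At ψ x) {γ : ℝ}
    (hγ : ∀ h : ι → ℝ, γ * ∑ x, h x ^ 2 ≤ ∑ x, h x * At h x) {v u u' : ℝ → ℝ} (hv : ∀ t, HasDerivAt v (u t) t)
    (hu : ∀ t, HasDerivAt u (u' t) t) {lam : ℝ} (hu' : ∀ t, -lam ≤ u' t) (hu0 : u 0 = 0) (ψ : ι → ℝ) :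
    ((1 / 2 : ℝ) * ∑ x, (0 : ι → ℝ) x * At 0 x + ∑ x, v ((0 : ι → ℝ) x)) + (γ - lam) / 2 * ∑ x, ψ x ^ 2
      ≤ (1 / 2 : ℝ) * ∑ x, ψ x * At ψ x + ∑ x, v (ψ x) := by
  have h := action_firstOrder_lower At hAt hγ hv hu hu' 0 ψ
  rw [fderiv_action_apply At hAt hv 0 (ψ - 0)] at h
  have h0 : ∑ x, (At 0 x + u ((0 : ι → ℝ) x)) * (ψ - 0) x = 0 := by simp [hu0]
  rw [h0, add_zero] at h
  simpa only [Pi.zero_apply, sub_zero] using h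

/-- **A STRONGLY MONOTONE MAP HAS A LIPSCHITZ INVERSE** (Cauchy–Schwarz): `m·Σ δ² ≤ Σ ε·δ` with `0 ≤ m` ⟹ `m²·Σ δ² ≤ Σ ε²`. [folklore] -/
theorem sq_sum_le_of_strongMonotone {m : ℝ} (hm : 0 ≤ m) (δ ε : κ → ℝ) (h : m * ∑ y, δ y ^ 2 ≤ ∑ y, ε y * δ y) :
    m ^ 2 * ∑ y, δ y ^ 2 ≤ ∑ y, ε y ^ 2 := by
  -- `(Σ εδ)² ≤ (Σ ε²)(Σ δ²)` (Cauchy–Schwarz for finite sums)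
  have hcs : (∑ y, ε y * δ y) ^ 2 ≤ (∑ y, ε y ^ 2) * ∑ y, δ y ^ 2 :=
    Finset.sum_mul_sq_le_sq_mul_sq (Finset.univ : Finset κ) ε δ
  have hδ : 0 ≤ ∑ y, δ y ^ 2 := Finset.sum_nonneg fun y _ => sq_nonneg _
  have hε : 0 ≤ ∑ y, ε y ^ 2 := Finset.sum_nonneg fun y _ => sq_nonneg _
  by_cases h0 : ∑ y, δ y ^ 2 = 0
  · rw [h0, mul_zero]; exact hε
  · have hpos : 0 < ∑ y, δ y ^ 2 := lt_of_le_of_ne hδ (Ne.symm h0)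
    have h2 : (m * ∑ y, δ y ^ 2) ^ 2 ≤ (∑ y, ε y ^ 2) * ∑ y, δ y ^ 2 :=
      (pow_le_pow_left₀ (mul_nonneg hm hδ) h 2).trans hcs
    have h3 : m ^ 2 * (∑ y, δ y ^ 2) * ∑ y, δ y ^ 2 ≤ (∑ y, ε y ^ 2) * ∑ y, δ y ^ 2 := by
      calc m ^ 2 * (∑ y, δ y ^ 2) * ∑ y, δ y ^ 2 = (m * ∑ y, δ y ^ 2) ^ 2 := by ring
        _ ≤ _ := h2
    exact le_of_mul_le_mul_right h3 hpos

end Generic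

/-! ## §2. The torus: the effective action is `C¹` everywhere; the vacuum; the Lipschitz inverse -/

section Torus

variable (n : ℕ) (a : ℝ) (s : ℕ) [NeZero s]
  {Dop Aop : lp (fun _ : X d => ℝ) ∞ →L[ℝ] lp (fun _ : X d => ℝ) ∞}
  (hD : ∀ (f : lp (fun _ : X d => ℝ) ∞) (y : X d), Dop f y = (((n : ℝ) + 1) ^ d)⁻¹ * ∑ p ∈ B n y, f p)
  (hA : ∀ (f : lp (fun _ : X d => ℝ) ∞) (p : X d), Aop f p = ∑ r ∈ nbhd n p, AX n a p r * f r)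
  {v u u' : ℝ → ℝ} (hv : ∀ t, HasDerivAt v (u t) t) (hu : ∀ t, HasDerivAt u (u' t) t)
  {lam : ℝ} (hu' : ∀ t, -lam ≤ u' t) (hγ : lam < min 2 a)
  {Ef : (Site d ((n + 1) * s) → ℝ) →L[ℝ] lp (fun _ : X d => ℝ) ∞}
  (hEf : ∀ (g : Site d ((n + 1) * s) → ℝ) (q : X d), Ef g q = g (siteOf d ((n + 1) * s) q))
  {Rf : lp (fun _ : X d => ℝ) ∞ →L[ℝ] (Site d ((n + 1) * s) → ℝ)}
  (hRf : ∀ (h : lp (fun _ : X d => ℝ) ∞) (x : Site d ((n + 1) * s)), Rf h x = h (windowMap d ((n + 1) * s) x))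
  {Rc : lp (fun _ : X d => ℝ) ∞ →L[ℝ] (Site d s → ℝ)}
  (hRc : ∀ (h : lp (fun _ : X d => ℝ) ∞) (x : Site d s), Rc h x = h (windowMap d s x))

include hD hEf hRc in
/-- **THE BLOCK LIFT IS A CONTINUOUS LINEAR RIGHT INVERSE OF THE TORUS BLOCK MEAN**: `∃ M`, `(M k) x = k (bt x)` and `Q′t (M k) = k`.
[folklore] -/
theorem exists_clm_blockLift :
    ∃ M : (Site d s → ℝ) →L[ℝ] (Site d ((n + 1) * s) → ℝ),
      (∀ (k : Site d s → ℝ) (x : Site d ((n + 1) * s)), M k x = k (siteOf d s (blk n (windowMap d ((n + 1) * s) x)))) ∧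
      ∀ k : Site d s → ℝ, ((Rc.comp Dop).comp Ef) (M k) = k := by
  refine ⟨ContinuousLinearMap.pi fun x : Site d ((n + 1) * s) =>
      ContinuousLinearMap.proj (R := ℝ) (φ := fun _ : Site d s => ℝ) (siteOf d s (blk n (windowMap d ((n + 1) * s) x))),
    fun k x => rfl, fun k => ?_⟩
  exact blockAvg_blockLift n s hD hEf hRc k

include hD hA hv hu hu' hγ hEf hRf hRc in
/-- **THE END: THE EFFECTIVE ACTION IS DIFFERENTIABLE AT EVERY BLOCK FIELD, GRADIENT = BLOCK VOLUME × NEXT EQUATION MAP.**  `u′ ≥ −λ`,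
`λ < min(2,a)`; `Φ` ANY background map (for every `w`: torus block means `Q′t (Φ w) = w` and the sitewise equation at `Φ w` — such a
map exists and is unique by (93)); `wt` any coarse field; `Lc` any covector with action `k ↦ Σ_y λ y·k y`, `λ` INST's next-equation
reading at `Φ wt`.  Then `HasFDerivAt (fun w ↦ S (Φ w)) ((n+1)^d • Lc) wt` — no differentiability of `Φ` is used or claimed. [folklore] -/
theorem torus_hasFDerivAt_effectiveAction_global (Φ : (Site d s → ℝ) → (Site d ((n + 1) * s) → ℝ))
    (hΦQ : ∀ w : Site d s → ℝ, ((Rc.comp Dop).comp Ef) (Φ w) = w)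
    (hΦeq : ∀ (w : Site d s → ℝ) (p : X d), Aop (Ef (Φ w)) p + u (Ef (Φ w) p)
      = (((n : ℝ) + 1) ^ d)⁻¹ * ∑ p' ∈ B n (blk n p), (Aop (Ef (Φ w)) p' + u (Ef (Φ w) p')))
    (wt : Site d s → ℝ) {Lc : (Site d s → ℝ) →L[ℝ] ℝ}
    (hLc : ∀ k : Site d s → ℝ, Lc k = ∑ y : Site d s,
      ((((n : ℝ) + 1) ^ d)⁻¹ * ∑ p' ∈ B n (windowMap d s y), (Aop (Ef (Φ wt)) p' + u (Ef (Φ wt) p'))) * k y) :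
    HasFDerivAt (fun w : Site d s → ℝ =>
        (1 / 2 : ℝ) * ∑ x, Φ w x * ((Rf.comp Aop).comp Ef) (Φ w) x + ∑ x, v (Φ w x))
      ((((n : ℝ) + 1) ^ d) • Lc) wt := by
  obtain ⟨M, -, hM⟩ := exists_clm_blockLift n s hD hEf hRc
  have hsymm := torus_operator_form_symm n a s hA hEf hRf
  have hcrit : ∀ (w : Site d s → ℝ) (h : Site d ((n + 1) * s) → ℝ), ((Rc.comp Dop).comp Ef) h = 0 →
      fderiv ℝ (fun φ : Site d ((n + 1) * s) → ℝ =>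
        (1 / 2 : ℝ) * ∑ x, φ x * ((Rf.comp Aop).comp Ef) φ x + ∑ x, v (φ x)) (Φ w) h = 0 :=
    fun w h hh => fderiv_action_torus_eq_zero n a s hD hA hEf hRf hRc hv (Φ w) (hΦeq w) h hh
  have hmain := hasFDerivAt_fibreMin_comp ((Rf.comp Aop).comp Ef) hsymm (torus_form_coercive n a s hA hEf hRf) hv hu hu' hγ.le
    ((Rc.comp Dop).comp Ef) M hM Φ hΦQ hcrit wt
  refine hmain.congr_fderiv (ContinuousLinearMap.ext fun k => ?_)
  rw [fderiv_fibreMin_comp_apply_of_pairing ((Rf.comp Aop).comp Ef) hsymm hv ((Rc.comp Dop).comp Ef) M hM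
    (pairing_of_sitewise n a s hD hA hEf hRf hRc (Φ wt) u (hΦeq wt)) k]
  show _ = ((n : ℝ) + 1) ^ d * Lc k
  rw [hLc]

include hD hA hv hu hu' hγ hEf hRf hRc in
/-- **THE BACKGROUND OF THE ZERO BLOCK FIELD IS THE ZERO FIELD** (`u 0 = 0`): the zero torus field has zero block means and solves the
sitewise equation, so it is the unique background of `wt = 0` ((93)). [folklore] -/
theorem torus_background_zero (hu0 : u 0 = 0) {φt : Site d ((n + 1) * s) → ℝ} (hQ : ((Rc.comp Dop).comp Ef) φt = 0)
    (heq : ∀ p : X d, Aop (Ef φt) p + u (Ef φt p)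
      = (((n : ℝ) + 1) ^ d)⁻¹ * ∑ p' ∈ B n (blk n p), (Aop (Ef φt) p' + u (Ef φt p'))) :
    φt = 0 := by
  obtain ⟨⟨φ0, -, huniq⟩, -⟩ := existsUnique_torus_background n a s hD hA hEf hRf hRc hv hu hu' hγ (0 : Site d s → ℝ)
  have hzero : (∀ p : X d, Aop (Ef (0 : Site d ((n + 1) * s) → ℝ)) p + u (Ef (0 : Site d ((n + 1) * s) → ℝ) p)
      = (((n : ℝ) + 1) ^ d)⁻¹ * ∑ p' ∈ B n (blk n p),
          (Aop (Ef (0 : Site d ((n + 1) * s) → ℝ)) p' + u (Ef (0 : Site d ((n + 1) * s) → ℝ) p'))) := fun p => by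
    simp [hu0]
  rw [huniq φt ⟨hQ, heq⟩, huniq 0 ⟨by rw [map_zero], hzero⟩]

include hA hv hu hu' hEf hRf in
/-- **THE VACUUM LETTER ON THE TORUS**: `u 0 = 0` ⟹ `S 0 + ½(min(2,a) − λ)·Σ_x φ x² ≤ S φ` for every torus field. [folklore] -/
theorem torus_action_vacuum_lower (hu0 : u 0 = 0) (φ : Site d ((n + 1) * s) → ℝ) :
    ((1 / 2 : ℝ) * ∑ x, (0 : Site d ((n + 1) * s) → ℝ) x * ((Rf.comp Aop).comp Ef) 0 x
        + ∑ x, v ((0 : Site d ((n + 1) * s) → ℝ) x)) + (min 2 a - lam) / 2 * ∑ x, φ x ^ 2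
      ≤ (1 / 2 : ℝ) * ∑ x, φ x * ((Rf.comp Aop).comp Ef) φ x + ∑ x, v (φ x) :=
  action_vacuum_lower ((Rf.comp Aop).comp Ef) (torus_operator_form_symm n a s hA hEf hRf) (torus_form_coercive n a s hA hEf hRf)
    hv hu hu' hu0 φ

include hD hA hv hu hu' hγ hEf hRf hRc in
/-- **THE VACUUM LETTER OF THE EFFECTIVE ACTION**: `u 0 = 0`, `λ < min(2,a)` ⟹ for every torus field `φ`,
`S 0 + ½(min(2,a) − λ)(n+1)^d·Σ_y ((Q′t φ) y)² ≤ S φ` — the effective action is minimised at the zero block field with quadratic gain.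
[folklore] -/
theorem torus_effectiveAction_vacuum_lower (hu0 : u 0 = 0) (φ : Site d ((n + 1) * s) → ℝ) :
    ((1 / 2 : ℝ) * ∑ x, (0 : Site d ((n + 1) * s) → ℝ) x * ((Rf.comp Aop).comp Ef) 0 x
        + ∑ x, v ((0 : Site d ((n + 1) * s) → ℝ) x))
        + (min 2 a - lam) / 2 * (((n : ℝ) + 1) ^ d * ∑ y, ((Rc.comp Dop).comp Ef) φ y ^ 2)
      ≤ (1 / 2 : ℝ) * ∑ x, φ x * ((Rf.comp Aop).comp Ef) φ x + ∑ x, v (φ x) := by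
  have h := torus_action_vacuum_lower n a s hA hv hu hu' hEf hRf hu0 φ
  have hJ : ((n : ℝ) + 1) ^ d * ∑ y, ((Rc.comp Dop).comp Ef) φ y ^ 2 ≤ ∑ x, φ x ^ 2 := by
    simpa only [ContinuousLinearMap.comp_apply] using blockVolume_mul_sum_sq_blockAvg_le n s hD hEf hRc φ
  have h3 := mul_le_mul_of_nonneg_left hJ (div_nonneg (sub_nonneg.2 hγ.le) zero_le_two)
  linarith

include hD hA hv hu hu' hγ hEf hRf hRc in
/-- **THE BLOCK FIELD IS A LIPSCHITZ FUNCTION OF THE RENORMALISED SOURCE**: two torus backgrounds `φt, φt′` (sitewise equation) with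
block means `w, w′` and next-equation readings `λ, λ′` satisfy `(min(2,a) − λ)²·Σ_y (w − w′)² ≤ Σ_y (λ − λ′)²`. [folklore] -/
theorem torus_blockField_le_of_nextEquation (φt φt' : Site d ((n + 1) * s) → ℝ)
    (heq : ∀ p : X d, Aop (Ef φt) p + u (Ef φt p)
      = (((n : ℝ) + 1) ^ d)⁻¹ * ∑ p' ∈ B n (blk n p), (Aop (Ef φt) p' + u (Ef φt p')))
    (heq' : ∀ p : X d, Aop (Ef φt') p + u (Ef φt' p)
      = (((n : ℝ) + 1) ^ d)⁻¹ * ∑ p' ∈ B n (blk n p), (Aop (Ef φt') p' + u (Ef φt' p'))) :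
    (min 2 a - lam) ^ 2 * ∑ y, (((Rc.comp Dop).comp Ef) φt y - ((Rc.comp Dop).comp Ef) φt' y) ^ 2
      ≤ ∑ y : Site d s,
          ((((n : ℝ) + 1) ^ d)⁻¹ * ∑ p' ∈ B n (windowMap d s y), (Aop (Ef φt) p' + u (Ef φt p'))
            - (((n : ℝ) + 1) ^ d)⁻¹ * ∑ p' ∈ B n (windowMap d s y), (Aop (Ef φt') p' + u (Ef φt' p'))) ^ 2 := by
  have hvol : (0 : ℝ) < ((n : ℝ) + 1) ^ d := by positivity
  have hmono := nextEquation_strongMonotone ((Rf.comp Aop).comp Ef) (torus_operator_form_symm n a s hA hEf hRf)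
    (torus_form_coercive n a s hA hEf hRf) hv hu hu' hγ.le ((Rc.comp Dop).comp Ef)
    (fun h => by simpa only [ContinuousLinearMap.comp_apply] using blockVolume_mul_sum_sq_blockAvg_le n s hD hEf hRc h)
    (pairing_of_sitewise n a s hD hA hEf hRf hRc φt u heq) (pairing_of_sitewise n a s hD hA hEf hRf hRc φt' u heq')
  -- divide the strong monotonicity letter by the block volume, then Cauchy–Schwarz
  have hmono' : (min 2 a - lam) * ∑ y, (((Rc.comp Dop).comp Ef) φt y - ((Rc.comp Dop).comp Ef) φt' y) ^ 2
      ≤ ∑ y : Site d s,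
          ((((n : ℝ) + 1) ^ d)⁻¹ * ∑ p' ∈ B n (windowMap d s y), (Aop (Ef φt) p' + u (Ef φt p'))
            - (((n : ℝ) + 1) ^ d)⁻¹ * ∑ p' ∈ B n (windowMap d s y), (Aop (Ef φt') p' + u (Ef φt' p')))
            * (((Rc.comp Dop).comp Ef) φt y - ((Rc.comp Dop).comp Ef) φt' y) := by
    rw [← mul_assoc, mul_comm (min 2 a - lam), mul_assoc] at hmono
    exact le_of_mul_le_mul_left hmono hvol
  exact sq_sum_le_of_strongMonotone (sub_nonneg.2 hγ.le) _ _ hmono'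

end Torus

/-! ## §3. Toy -/

/-- Toy (§1): the identity map of `Unit → ℝ` is `1`-strongly monotone, so `1²·Σ δ² ≤ Σ δ²`. -/
example (δ : Unit → ℝ) : (1 : ℝ) ^ 2 * ∑ y, δ y ^ 2 ≤ ∑ y, δ y ^ 2 :=
  sq_sum_le_of_strongMonotone zero_le_one δ δ (by simp [sq])

end Summit.QuantumFields.BalabanUV.T4Continuum.NE7b.SupTorusEffectiveActionGradient

end
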